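import Mathlib
import Summits.CriticalPhenomena.SAWScalingLimit.Theorems.SAWDefectDecoherenceObservableToSLERAdaptedGateDefs
import Summits.CriticalPhenomena.SAWScalingLimit.Theorems.SAWDefectDecoherenceObservableToSLERGateTransferProductCells

/-!
# Product cells over domain-adapted gate families (stub `stub_productCellsA`)

Support file for the line `bridge-gate-renewal` (reshape r3: domain-adapted gates) of the crux
`Summit.CriticalPhenomena.SAWScalingLimit.Theses.SAWDefectDecoherence.ObservableToSLER`
(item `stmt-CriticalPhenomena-14005`), registered stub `stub_productCellsA`
(`ProductCellStructure`): for a Dobrushin domain with an endpoint approximation there is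
`R₁ > 0` such that for every locality scale `R ≤ R₁`, every window radius `ρ`, all small
meshes `δ`, and all admissible gate families `Fa` (rooted at `a δ`) and `Fb` (rooted at `b δ`),
every critical SAW `γ₀` lies in the product cell `productCellIn … (3 R)` of its first good gates.

Contents (pure list / set algebra over the vocabulary of
`SAWDefectDecoherenceObservableToSLERAdaptedGateDefs`; no planar topology):

* index bookkeeping for `IsCrossedOnce` (`getElem?_eq`, `pos`, `lt_length`, `getElem?_pred_eq`,
  membership of `p`, `q`, adjacency of the crossing edge);
* `isFirstGoodGateIn_transfer` — ONE-SIDED TRANSFER of the first good gate: if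
  `l₁ ++ mid₀ ++ l₂` has first good gate `(κ; m, p, q)` in a family with NESTED root sides and
  `l₁.length = m`, then so does every `l₁ ++ mid ++ l₂` with `mid` starting at `q` and avoiding
  the root side of `κ` (minimality transfers through the nesting clause);
* `productCellsA` / `stub_productCellsA` — the cell structure, eventually in the mesh: the two
  root sides lie in the disjoint balls `B(δ·â_δ, R)`, `B(δ·b̂_δ, R)`, prefix and suffix are
  sub-walks inside them, the middle piece is nonempty, the first good gates transfer, and the
  prefix (suffix) stays within `3 R` of `q` (`q'`).
-/

noncomputable section

open scoped BigOperators Topology NNReal ENNReal Classical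
open Filter Set MeasureTheory Metric
open Literature.Probability.LatticeModels (HexVertex hexGraph hexCenter triZeta Site)
open Literature.Probability.RandomPlanarGeometry
open Literature.Probability.RandomPlanarGeometry.SAW

namespace Summit.CriticalPhenomena.SAWScalingLimit.Theorems.ObservableToSLER.BridgeGate

section CrossedOnce

variable {Ω : Set ℂ} {δ ρ : ℝ} {c : HexVertex} {κ : Set ℂ} {l : List HexVertex} {m : ℕ}
  {p q : HexVertex}

/-- In a single crossing the entry at the crossing index is `q`. -/
theorem IsCrossedOnce.getElem?_eq (h : IsCrossedOnce Ω δ ρ c κ l m p q) : l[m]? = some q := by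
  rw [← List.head?_drop]; exact h.2.1

/-- In a single crossing the crossing index is positive. -/
theorem IsCrossedOnce.pos (h : IsCrossedOnce Ω δ ρ c κ l m p q) : 0 < m := by
  rcases Nat.eq_zero_or_pos m with rfl | hm
  · exact absurd h.1 (by simp)
  · exact hm

/-- In a single crossing the crossing index is less than the length of the list. -/
theorem IsCrossedOnce.lt_length (h : IsCrossedOnce Ω δ ρ c κ l m p q) : m < l.length := by
  have := h.getElem?_eq
  rw [List.getElem?_eq_some_iff] at this
  exact this.1

/-- In a single crossing the last root-side vertex is the entry at index `m - 1`. -/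
theorem IsCrossedOnce.getElem?_pred_eq (h : IsCrossedOnce Ω δ ρ c κ l m p q) :
    l[m - 1]? = some p := by
  have hm := h.pos
  have hml := h.lt_length
  have h1 := h.1
  rw [List.getLast?_eq_getElem?, List.length_take, min_eq_left hml.le, List.getElem?_take] at h1
  simpa [Nat.sub_lt hm one_pos] using h1

/-- In a single crossing, `p` is one of the first `m` entries. -/
theorem IsCrossedOnce.fst_mem_take (h : IsCrossedOnce Ω δ ρ c κ l m p q) : p ∈ l.take m :=
  List.mem_of_getElem? (by
    rw [List.getElem?_take, if_pos (Nat.sub_lt h.pos one_pos)]; exact h.getElem?_pred_eq)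

/-- In a single crossing, `q` is one of the entries from index `m` on. -/
theorem IsCrossedOnce.snd_mem_drop (h : IsCrossedOnce Ω δ ρ c κ l m p q) : q ∈ l.drop m :=
  List.mem_iff_getElem?.2 ⟨0, by rw [List.getElem?_drop, Nat.add_zero]; exact h.getElem?_eq⟩

/-- In a single crossing, `p` lies in the root side. -/
theorem IsCrossedOnce.fst_mem_verts (h : IsCrossedOnce Ω δ ρ c κ l m p q) :
    p ∈ cutSideVerts Ω κ δ c :=
  h.2.2.2.1 p h.fst_mem_take

/-- In a single crossing, `q` lies off the root side. -/
theorem IsCrossedOnce.snd_not_mem_verts (h : IsCrossedOnce Ω δ ρ c κ l m p q) :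
    q ∉ cutSideVerts Ω κ δ c :=
  h.2.2.2.2.1 q h.snd_mem_drop

/-- In a single crossing of a walk of `Ω'_δ'`, the crossing edge `{p, q}` is an edge of `Ω'_δ'`. -/
theorem IsCrossedOnce.adj {Ω' : Set ℂ} {δ' : ℝ} {u v : HexVertex}
    (w : (hexDomainGraph Ω' δ').Walk u v) (h : IsCrossedOnce Ω δ ρ c κ w.support m p q) :
    (hexDomainGraph Ω' δ').Adj p q := by
  have hm := h.pos
  have hml := h.lt_length
  have hp := h.getElem?_pred_eq
  have hq := h.getElem?_eq
  rw [List.getElem?_eq_some_iff] at hp hq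
  obtain ⟨_, rfl⟩ := hp
  obtain ⟨_, rfl⟩ := hq
  have := adj_of_getElem w (i := m - 1) (by omega)
  simpa [Nat.sub_add_cancel hm] using this

end CrossedOnce

section Transfer

variable {Ω : Set ℂ} {δ ρ : ℝ} {c : HexVertex} {F : Set (Set ℂ)}

/-- **One-sided transfer of the first good gate over a family with nested root sides.**  If
`L₀ = l₁ ++ mid₀ ++ l₂` has first good gate `(κ; m, p, q)` in `F` with `l₁.length = m`, then every
list `L = l₁ ++ mid ++ l₂` whose middle piece `mid` starts at `q` and avoids the root side of `κ`
has the same first good gate: `κ` is crossed once by `L` clause by clause (`l₂` is part of the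
suffix of `L₀`), and a good crossing of `κ₂ ∈ F` by `L` at `m₂ < m` is impossible — if the root
side of `κ₂` lies in that of `κ`, it would be a good crossing of `κ₂` by `L₀` at `m₂`
(contradicting minimality for `L₀`); if the root side of `κ` lies in that of `κ₂`, the entry
`p` of `L` at index `m - 1 ≥ m₂` lies in the root side of `κ₂`, which the suffix of `L` after
`m₂` avoids. -/
theorem isFirstGoodGateIn_transfer
    (hnest : ∀ κ ∈ F, ∀ κ' ∈ F,
      cutSide Ω κ δ c ⊆ cutSide Ω κ' δ c ∨ cutSide Ω κ' δ c ⊆ cutSide Ω κ δ c)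
    {κ : Set ℂ} {m : ℕ} {p q : HexVertex} {L₀ L l₁ mid₀ mid l₂ : List HexVertex}
    (h₀ : IsFirstGoodGateIn Ω δ ρ c F L₀ κ m p q) (hL₀ : L₀ = l₁ ++ mid₀ ++ l₂)
    (hL : L = l₁ ++ mid ++ l₂) (hl₁ : l₁.length = m) (hmid : mid.head? = some q)
    (hmidS : ∀ v ∈ mid, v ∉ cutSideVerts Ω κ δ c) :
    IsFirstGoodGateIn Ω δ ρ c F L κ m p q := by
  subst hl₁ hL₀ hL
  obtain ⟨hκ, hc₀, hmin₀⟩ := h₀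
  have htake₀ : (l₁ ++ mid₀ ++ l₂).take l₁.length = l₁ := by
    rw [List.append_assoc, List.take_append_of_le_length le_rfl, List.take_length]
  have hdrop₀ : (l₁ ++ mid₀ ++ l₂).drop l₁.length = mid₀ ++ l₂ := by
    rw [List.append_assoc, List.drop_append_of_le_length le_rfl, List.drop_length, List.nil_append]
  have htake : (l₁ ++ mid ++ l₂).take l₁.length = l₁ := by
    rw [List.append_assoc, List.take_append_of_le_length le_rfl, List.take_length]
  have hdrop : (l₁ ++ mid ++ l₂).drop l₁.length = mid ++ l₂ := by
    rw [List.append_assoc, List.drop_append_of_le_length le_rfl, List.drop_length, List.nil_append]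
  -- `κ` is crossed once by `L`, clause by clause
  have hc : IsCrossedOnce Ω δ ρ c κ (l₁ ++ mid ++ l₂) l₁.length p q := by
    refine ⟨?_, ?_, hc₀.2.2.1, ?_, ?_, hc₀.2.2.2.2.2⟩
    · rw [htake, ← htake₀]; exact hc₀.1
    · rw [hdrop, List.head?_append, hmid]; rfl
    · rw [htake, ← htake₀]; exact hc₀.2.2.2.1
    · intro v hv
      rw [hdrop, List.mem_append] at hv
      rcases hv with hv | hv
      · exact hmidS v hv
      · exact hc₀.2.2.2.2.1 v (by rw [hdrop₀]; exact List.mem_append_right _ hv)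
  refine ⟨hκ, hc, fun κ₂ hκ₂ m₂ p₂ q₂ hc₂ => ?_⟩
  -- minimality
  by_contra hle
  have hlt : m₂ < l₁.length := Nat.lt_of_not_le hle
  have htake₂ : (l₁ ++ mid₀ ++ l₂).take m₂ = (l₁ ++ mid ++ l₂).take m₂ := by
    rw [List.append_assoc, List.append_assoc, List.take_append_of_le_length hlt.le,
      List.take_append_of_le_length hlt.le]
  have hidx : (l₁ ++ mid₀ ++ l₂)[m₂]? = (l₁ ++ mid ++ l₂)[m₂]? := by
    rw [List.append_assoc, List.append_assoc, List.getElem?_append_left hlt,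
      List.getElem?_append_left hlt]
  have hdrop₂₀ : (l₁ ++ mid₀ ++ l₂).drop m₂ = l₁.drop m₂ ++ (mid₀ ++ l₂) := by
    rw [List.append_assoc, List.drop_append_of_le_length hlt.le]
  have hdrop₂ : (l₁ ++ mid ++ l₂).drop m₂ = l₁.drop m₂ ++ (mid ++ l₂) := by
    rw [List.append_assoc, List.drop_append_of_le_length hlt.le]
  rcases hnest κ₂ hκ₂ κ hκ with hsub | hsub
  · -- the root side of `κ₂` lies in that of `κ`: a good crossing of `κ₂` by `L₀` at `m₂`
    have hc₂₀ : IsCrossedOnce Ω δ ρ c κ₂ (l₁ ++ mid₀ ++ l₂) m₂ p₂ q₂ := by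
      refine ⟨by rw [htake₂]; exact hc₂.1, ?_, hc₂.2.2.1, by rw [htake₂]; exact hc₂.2.2.2.1, ?_,
        hc₂.2.2.2.2.2⟩
      · rw [List.head?_drop, hidx, ← List.head?_drop]; exact hc₂.2.1
      · intro v hv
        rw [hdrop₂₀, List.mem_append] at hv
        rcases hv with hv | hv
        · exact hc₂.2.2.2.2.1 v (by rw [hdrop₂]; exact List.mem_append_left _ hv)
        · exact fun h => hc₀.2.2.2.2.1 v (by rw [hdrop₀]; exact hv) (hsub h)
    exact hle (hmin₀ κ₂ hκ₂ m₂ p₂ q₂ hc₂₀)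
  · -- the root side of `κ` lies in that of `κ₂`: `p` comes after index `m₂` in `L`
    have hpS : p ∈ cutSideVerts Ω κ δ c := hc₀.fst_mem_verts
    have hp : l₁[l₁.length - 1]? = some p := by
      have := hc₀.1
      rwa [htake₀, List.getLast?_eq_getElem?] at this
    have hpdrop : p ∈ (l₁ ++ mid ++ l₂).drop m₂ := by
      rw [List.mem_iff_getElem?]
      refine ⟨l₁.length - 1 - m₂, ?_⟩
      rw [List.getElem?_drop, show m₂ + (l₁.length - 1 - m₂) = l₁.length - 1 by omega,
        List.append_assoc, List.getElem?_append_left (by omega)]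
      exact hp
    exact hc₂.2.2.2.2.1 p hpdrop (hsub hpS)

end Transfer

section ProductCellsA

/-- The root-side vertices of a member of an admissible family lie in the open `R`-ball about
the rescaled root (locality clause). -/
theorem dist_lt_of_mem_cutSideVerts {Ω : Set ℂ} {δ R : ℝ} {c far : HexVertex} {F : Set (Set ℂ)}
    (hF : IsAdmissibleFamily Ω δ R c far F) {κ : Set ℂ} (hκ : κ ∈ F) {v : HexVertex}
    (hv : v ∈ cutSideVerts Ω κ δ c) :
    dist ((δ : ℂ) * hexCenter v) ((δ : ℂ) * hexCenter c) < R := by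
  have := (hF.2.2 κ hκ).2.2.2.2.2.2.2.2 (Or.inl hv)
  rwa [mem_ball] at this

/-- **THE CELL STRUCTURE OVER ADAPTED GATES, EVENTUALLY.**  For a Dobrushin domain with an
endpoint approximation, with `R₁ := dist(a, b) / 8`: for `R ≤ R₁`, any `ρ`, all small `δ`
(`δ < R / 4`, `δ·â_δ ∈ B(a, R)`, `δ·b̂_δ ∈ B(b, R)`) and admissible `Fa`, `Fb`, every critical SAW
lies in `productCellIn … (3 R)`: the two root sides lie in the balls `B(δâ_δ, R)`, `B(δb̂_δ, R)`,
which are `> 6R` apart, hence are disjoint; prefix and suffix are sub-walks inside them; `q` is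
within `2R` of `δâ_δ` hence not in the far root side, so the middle piece is nonempty; the first
good gates transfer (`isFirstGoodGateIn_transfer`, twice); distances by the triangle inequality. -/
theorem productCellsA (D : DobrushinDomain) (a b : ℝ → HexVertex)
    (hab : IsEmbEndpointApprox hexGraph hexCenter D a b) :
    ∃ R₁ > (0 : ℝ), ∀ R ∈ Set.Ioc (0 : ℝ) R₁, ∀ ρ > (0 : ℝ), ∀ᶠ δ : ℝ in 𝓝[>] 0,
      ∀ Fa Fb : Set (Set ℂ), IsAdmissibleFamily D.carrier δ R (a δ) (b δ) Fa →
        IsAdmissibleFamily D.carrier δ R (b δ) (a δ) Fb →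
        ∀ γ₀ : HexDomainSAW D.carrier δ (a δ) (b δ),
          γ₀ ∈ productCellIn D.carrier δ ρ Fa Fb (a δ) (b δ) (3 * R) := by
  set za := D.pt 0 with hza
  set zb := D.pt 1 with hzb
  set d := dist za zb with hd
  have hd0 : 0 < d := dist_pos.2 (DobrushinDomain_pt_ne D)
  refine ⟨d / 8, by positivity, ?_⟩
  rintro R ⟨hR0, hR1⟩ ρ -
  have hA := Metric.tendsto_nhds.1 hab.tendsto_fst R hR0
  have hB := Metric.tendsto_nhds.1 hab.tendsto_snd R hR0
  have hsmall : ∀ᶠ δ : ℝ in 𝓝[>] 0, δ < R / 4 :=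
    (eventually_lt_nhds (by positivity : (0 : ℝ) < R / 4)).filter_mono nhdsWithin_le_nhds
  filter_upwards [hA, hB, hsmall, self_mem_nhdsWithin] with δ hAδ hBδ hδR hδ0
  replace hδ0 : 0 < δ := hδ0
  have hab' : 6 * R < dist ((δ : ℂ) * hexCenter (a δ)) ((δ : ℂ) * hexCenter (b δ)) := by
    have := dist_triangle4 za ((δ : ℂ) * hexCenter (a δ)) ((δ : ℂ) * hexCenter (b δ)) zb
    linarith [dist_comm za ((δ : ℂ) * hexCenter (a δ))]
  -- adjacent vertices of `Ω_δ` have rescaled centres within `4 δ < R`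
  have hdadj : ∀ {u v : HexVertex}, (hexDomainGraph D.carrier δ).Adj u v →
      dist ((δ : ℂ) * hexCenter u) ((δ : ℂ) * hexCenter v) < R := by
    intro u v huv
    have hk := abs_rowCoord_sub_le_one_of_adj ((adj_hexDomainGraph_iff).1 huv).1.1
    have h := dist_hexCenter_le (v := u) (w := v) (k := 1) (by exact_mod_cast hk 0)
      (by exact_mod_cast hk 1)
    have h4 : ‖hexCenter u - hexCenter v‖ ≤ 4 := by rw [← dist_eq_norm]; linarith
    rw [dist_eq_norm, ← mul_sub, norm_mul, Complex.norm_real, Real.norm_eq_abs, abs_of_pos hδ0]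
    calc δ * ‖hexCenter u - hexCenter v‖ ≤ δ * 4 := mul_le_mul_of_nonneg_left h4 hδ0.le
      _ < R := by linarith
  intro Fa Fb hFa hFb γ₀ κ m p q κ' m' p' q' h₁ h₂
  set L₀ := γ₀.walk.support with hL₀
  have hrev : γ₀.walk.reverse.support = L₀.reverse := SimpleGraph.Walk.support_reverse _
  have hc₁ : IsCrossedOnce D.carrier δ ρ (a δ) κ L₀ m p q := h₁.2.1
  have hc₂ : IsCrossedOnce D.carrier δ ρ (b δ) κ' L₀.reverse m' p' q' := h₂.2.1
  have hc₂' : IsCrossedOnce D.carrier δ ρ (b δ) κ' γ₀.walk.reverse.support m' p' q' := by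
    rw [hrev]; exact hc₂
  have hml := hc₁.lt_length
  have hml' : m' < L₀.length := by have := hc₂.lt_length; rwa [List.length_reverse] at this
  -- the two root sides lie in the balls `B(δâ, R)`, `B(δb̂, R)`, hence are disjoint
  have hSa : ∀ v ∈ cutSideVerts D.carrier κ δ (a δ),
      dist ((δ : ℂ) * hexCenter v) ((δ : ℂ) * hexCenter (a δ)) < R :=
    fun v hv => dist_lt_of_mem_cutSideVerts hFa h₁.1 hv
  have hTb : ∀ v ∈ cutSideVerts D.carrier κ' δ (b δ),
      dist ((δ : ℂ) * hexCenter v) ((δ : ℂ) * hexCenter (b δ)) < R :=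
    fun v hv => dist_lt_of_mem_cutSideVerts hFb h₂.1 hv
  have hST : Disjoint (cutSideVerts D.carrier κ δ (a δ)) (cutSideVerts D.carrier κ' δ (b δ)) := by
    refine Set.disjoint_left.2 fun v hva hvb => ?_
    have h1 := hSa v hva
    have h2 := hTb v hvb
    have := dist_triangle ((δ : ℂ) * hexCenter (a δ)) ((δ : ℂ) * hexCenter v)
      ((δ : ℂ) * hexCenter (b δ))
    linarith [dist_comm ((δ : ℂ) * hexCenter (a δ)) ((δ : ℂ) * hexCenter v)]
  -- the prefix lies in `S`, the suffix in `T`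
  have hpre : ∀ v ∈ L₀.take m, v ∈ cutSideVerts D.carrier κ δ (a δ) := hc₁.2.2.2.1
  have hsuf : ∀ v ∈ L₀.drop (L₀.length - m'), v ∈ cutSideVerts D.carrier κ' δ (b δ) := by
    intro v hv
    rw [mem_drop_length_sub_iff] at hv
    exact hc₂.2.2.2.1 v hv
  -- the crossing edges
  have hpq : (hexDomainGraph D.carrier δ).Adj p q := hc₁.adj γ₀.walk
  have hp'q' : (hexDomainGraph D.carrier δ).Adj p' q' := hc₂'.adj γ₀.walk.reverse
  -- `q` is not in `T`, so the middle piece is nonempty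
  have hq := hc₁.getElem?_eq
  have hqT : q ∉ cutSideVerts D.carrier κ' δ (b δ) := by
    intro hqT
    have h1 := hSa p hc₁.fst_mem_verts
    have h2 := hTb q hqT
    have h3 := hdadj hpq
    have := dist_triangle4 ((δ : ℂ) * hexCenter (a δ)) ((δ : ℂ) * hexCenter p)
      ((δ : ℂ) * hexCenter q) ((δ : ℂ) * hexCenter (b δ))
    linarith [dist_comm ((δ : ℂ) * hexCenter p) ((δ : ℂ) * hexCenter (a δ))]
  have hlen : m + m' < L₀.length := by
    by_contra hle
    refine hqT (hsuf q (List.mem_iff_getElem?.2 ⟨m - (L₀.length - m'), ?_⟩))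
    rw [List.getElem?_drop, show L₀.length - m' + (m - (L₀.length - m')) = m by omega]
    exact hq
  -- the walks of the prefix and of the suffix
  have hw₁ := exists_walk_take γ₀.walk γ₀.isPath hc₁.1
  have hhead' : (L₀.drop (L₀.length - m')).head? = some p' := by
    have := hc₂.1
    rwa [List.take_reverse, List.getLast?_reverse] at this
  have hw₂ := exists_walk_drop γ₀.walk γ₀.isPath hhead'
  refine ⟨hST, ?_, ?_, hpq, hp'q'.symm, hlen, ?_, ?_, ?_⟩
  · obtain ⟨w₁, hw₁p, hw₁s⟩ := hw₁
    exact ⟨w₁, hw₁p, hw₁s, hpre⟩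
  · obtain ⟨w₂, hw₂p, hw₂s⟩ := hw₂
    exact ⟨w₂, hw₂p, hw₂s, hsuf⟩
  · -- the transfer of the first good gates
    intro γ mid hh hl hav hsupp
    have hsplit : L₀ = L₀.take m ++ midList m m' L₀ ++ L₀.drop (L₀.length - m') :=
      (take_append_midList_append_drop hlen.le).symm
    have hl₁ : (L₀.take m).length = m := by rw [List.length_take]; exact min_eq_left hml.le
    have hl₂ : (L₀.drop (L₀.length - m')).length = m' := by rw [List.length_drop]; omega
    constructor
    · exact isFirstGoodGateIn_transfer hFa.2.1 h₁ hsplit hsupp hl₁ hh (fun v hv => (hav v hv).1)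
    · have hsplit' : L₀.reverse = (L₀.drop (L₀.length - m')).reverse ++ (midList m m' L₀).reverse ++
          (L₀.take m).reverse := by
        conv_lhs => rw [hsplit]
        rw [List.reverse_append, List.reverse_append, List.append_assoc]
      have hsupp' : γ.walk.support.reverse = (L₀.drop (L₀.length - m')).reverse ++ mid.reverse ++
          (L₀.take m).reverse := by
        rw [hsupp, List.reverse_append, List.reverse_append, List.append_assoc]
      refine isFirstGoodGateIn_transfer hFb.2.1 h₂ hsplit' hsupp' (by rw [List.length_reverse, hl₂])
        (by rw [List.head?_reverse, hl]) ?_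
      intro v hv
      rw [List.mem_reverse] at hv
      exact (hav v hv).2
  · intro x hx
    have h1 := hSa x (hpre x hx)
    have h2 := hSa p hc₁.fst_mem_verts
    have h3 := hdadj hpq
    have := dist_triangle4 ((δ : ℂ) * hexCenter x) ((δ : ℂ) * hexCenter (a δ))
      ((δ : ℂ) * hexCenter p) ((δ : ℂ) * hexCenter q)
    linarith [dist_comm ((δ : ℂ) * hexCenter p) ((δ : ℂ) * hexCenter (a δ))]
  · intro x hx
    have h1 := hTb x (hsuf x hx)
    have h2 := hTb p' hc₂.fst_mem_verts
    have h3 := hdadj hp'q'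
    have := dist_triangle4 ((δ : ℂ) * hexCenter x) ((δ : ℂ) * hexCenter (b δ))
      ((δ : ℂ) * hexCenter p') ((δ : ℂ) * hexCenter q')
    linarith [dist_comm ((δ : ℂ) * hexCenter p') ((δ : ℂ) * hexCenter (b δ))]

end ProductCellsA

end Summit.CriticalPhenomena.SAWScalingLimit.Theorems.ObservableToSLER.BridgeGate

namespace Summit.CriticalPhenomena.SAWScalingLimit.Theorems.ObservableToSLER.BridgeGate

/-- **Registered stub `stub_productCellsA`** of the line `bridge-gate-renewal` (r3, adapted
gates): the product-cell structure over admissible gate families, eventually in the mesh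
(self-contained form of `productCellsA`). -/
theorem stub_productCellsA :
    ∀ (D : DobrushinDomain) (a b : ℝ → HexVertex), IsEmbEndpointApprox hexGraph hexCenter D a b →
      ∃ R₁ > (0 : ℝ), ∀ R ∈ Set.Ioc (0 : ℝ) R₁, ∀ ρ > (0 : ℝ), ∀ᶠ δ : ℝ in 𝓝[>] 0,
        ∀ Fa Fb : Set (Set ℂ), IsAdmissibleFamily D.carrier δ R (a δ) (b δ) Fa →
          IsAdmissibleFamily D.carrier δ R (b δ) (a δ) Fb →
          ∀ γ₀ : HexDomainSAW D.carrier δ (a δ) (b δ),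
            γ₀ ∈ productCellIn D.carrier δ ρ Fa Fb (a δ) (b δ) (3 * R) := by
  intro D a b hab
  exact productCellsA D a b hab

end Summit.CriticalPhenomena.SAWScalingLimit.Theorems.ObservableToSLER.BridgeGate

end
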